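import Literature.Barriers.CriticalPhenomena.LaceExpansionIsingDeconvolutionParts
import Literature.Analysis.FunctionSpaces.TorusTestFunction
import HarnessLib

/-!
# Liu–Slade 2024, Theorem 1.2 (Gaussian deconvolution) decomposed along its printed proof

Barrier catalogue `Literature/Barriers/CriticalPhenomena/` (D-0021), companion of
`LaceExpansionIsingDeconvolutionParts.lean`. That file vendors, among the inputs of Liu–Slade 2026,
Theorem 1.7, the named fact `LiuSlade2024_thm12_critical`: Liu–Slade 2024, Theorem 1.2 (the
general Gaussian deconvolution theorem `G(x) = λC_μ(x) + O(⟦x⟧^{-(d-2+s)})` for the solution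
`G = ∫ e^{-ik·x}/F̂` of `F * G = δ` under Assumption 1.1) in the critical case `F̂(0) = 0`, where it
reads `G(x) = a_d/(F''⟦x⟧^{d-2}) + O(⟦x⟧^{-(d-2+s)})`. Its printed proof (§2 and Appendix A of the
source) is a THEORY — `L^p` Fourier analysis of weak derivatives on `𝕋^d` (product and quotient
rules, Hausdorff–Young, the torus Sobolev inequality) and a fractional-derivative analysis — none of
which is in Mathlib. This file records the architecture of that proof in Lean: the objects of §2
and Appendix A are defined over Mathlib's `UnitAddTorus (Fin d)` (the setting of the Parts file:
`latticeFourier`, `fourierInverseG`, coordinate `k = 2πt`), and deep intermediate results of the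
printed proof are vendored as NAMED FACTS stated over them (Part B); the companion
`LaceExpansionGaussianDeconvolutionLem29.lean` discharges two of them (`LiuSlade2024_lem29_holds`,
`srwGreen_eq_fourierInverseG_holds`) and proves Lemma 2.3 (`LiuSlade2024_lem23`). The assembly of
`LiuSlade2024_thm12_critical` from the parts along the source's "Proof of Theorem 1.2 assuming
Proposition 2.11" (§2.3.2), with the elementary analysis it needs, is the sibling
`LaceExpansionGaussianDeconvolutionProofs.lean` (`LiuSlade2024_thm12_critical_of_prop24`, landed
2026-08-15; see the section "In the sibling" below), in which Proposition 2.11 — no longer vendored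
as a named fact (see Part B and "Withdrawn transcription of Proposition 2.11") — enters as an
explicit hypothesis, spelled out.

## Objects (Part A)

* `iterPartialDeriv l φ` — `∇^α φ` for a test function on the torus, multi-indices being words
  `l` of coordinate directions (`|α| = l.length`), over the tree's `Torus.partialDeriv`;
* `HasTorusWeakDeriv u l v` — Appendix A, Definition A.1: `u, v ∈ L¹(𝕋^d)` and
  `∫ u ∇^l φ = (-1)^{|l|} ∫ v φ` for all smooth real test functions (`Torus.IsSmooth`); for
  `l = [j]` this is the tree's `Torus.HasWeakPartialDeriv j u v`;
* `torusDiff j u g` — the difference operator `U_u g = g(· + ue_j) - g(· - ue_j)` of §2.3.1;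
  `torusSignedPerm` — the dual action of the `ℤ^d`-symmetries on the torus;
* `LS24Assumption d K₁ K₂ ρ F` — Assumption 1.1 (in the coordinate `k = 2πt`);
* `lsA d μ = δ - μD_nn` (`A_μ`), `ls24Fpp F = -Σ|x|²F(x)` (`F''`, (1.10)), `ls24Lambda`, `ls24Mu`
  ((1.12)), `ls24fHat F = 1/F̂ - λ/Â_μ` (`f̂ = ĈÊĜ`, §2.1 and Prop. 2.4).

## Named facts (Part B; deep inputs, not proved here, each as printed over the objects above)

* `LiuSlade2024_lem29` — Lemma 2.9 (decay `|h(x)| ≲ ⟦x⟧^{-a}` from `⌊a⌋` weak derivatives and a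
  Hölder estimate on `U_u ĥ_α`; behind it Lemma 2.8);
* `LiuSlade2024_prop24` — Proposition 2.4 (`f̂` is `n_d` times weakly differentiable, with the
  `L¹` bounds of its proof), uniformly in `F` as asserted by Theorem 1.2;
* Proposition 2.11 (`‖U_u f̂_α‖₁ ≲ u^η` for `|α| ≤ n_d`, uniformly in `F`), the remaining input of
  the assembly, is NOT vendored: its transcription `LiuSlade2024_prop211` (landed with this file,
  p24184) was withdrawn on the review of split children (D-0026/D-0027, 2026-08-15) and merged
  back into the obligation `LiuSlade2024_thm12_critical`, because its printed proof is not a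
  separable piece of the parent's proof but essentially all of it: "Proof of Proposition 2.11
  assuming Lemma 2.12" (§2.3.2) and the proof of Lemma 2.12 (§2.3.3) rest on the decomposition
  of `f̂_α` into products of factors `Â_δ/Â`, `Ê_{α₂}/(ÂF̂)`, `F̂_γ/F̂` (the display preceding
  Lemma 2.5, re-displayed before Lemma 2.12) and on Lemma 2.5, i.e. on the whole proof of
  Proposition 2.4 (§2.2.1–§2.2.2, through the weak product and quotient rules of Appendix A,
  Lemmas A.2–A.3, the latter via the ACL characterisation of weakly differentiable functions),
  on Lemma 2.10 (the torus Sobolev inequality of Bényi–Oh, the source's reference BO13, with the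
  log-convexity of `L^p` norms and Minkowski's integral inequality), on Lemmas 2.13–2.14 (the
  Hausdorff–Young inequality, the source's reference Foll15) and on Lemmas 2.2 and 2.6 — none of
  which is in Mathlib (no `L^p` Sobolev inequality on `𝕋^d`, no Hausdorff–Young / Riesz–Thorin,
  first-order weak derivatives only). The exact reviewed reading is kept below;
* `srwGreen_eq_fourierInverseG` — "`C_1(x)` is the expected number of visits to `x`": the Fourier
  integral (1.5) at `μ = 1` equals `Σ_n D_nn^{*n}(x)` (`srwGreen`) for `d > 2`.
(The asymptotics (1.6) of `C_1` are the Parts file's `srwGreen_asymp`.)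

## Withdrawn transcription of Proposition 2.11 (for the prover of `LiuSlade2024_thm12_critical`)

"Let `|α| ≤ n_d`, `0 ≤ u ≤ 1`, and suppose `η ∈ (0,1)` satisfies
`n_d + η < (d - 2 + ρ ∧ 2) ∧ (d/2 + 2 + ρ)`. If `F` obeys Assumption 1.1, then
`‖U_u f̂_α‖₁ ≲ u^η`." The reading reviewed with p24184 — `d > 2`; `f̂_α` any `α`-th weak
derivative `v` of `f̂ = ls24fHat F` (Definition A.1, unique a.e.); `U_u = torusDiff j u` in every
coordinate direction `j` (the source's direction `1` is every direction by the `ℤ^d`-symmetry of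
`F`) with `u ∈ [0,1]` in the coordinate `t = k/2π` (shifts up to `2π` in `k`; equivalent up to the
constant by telescoping `U_{nu}` into `n` translates of `U_u`); one constant for all `F` under
Assumption 1.1 with given `d, K₁, K₂, ρ, η` (the uniformity clause of Theorem 1.2, "The error
estimate depends only on `d, K₁, K₂, ρ, s`") — was, verbatim:

```
∀ d : ℕ, 2 < d → ∀ K₁ K₂ ρ η : ℝ, 0 < K₁ → 0 < K₂ → max (((d : ℝ) - 8) / 2) 0 < ρ →
  0 < η → η < 1 →
  (lsND d ρ : ℝ) + η < min ((d : ℝ) - 2 + min ρ 2) ((d : ℝ) / 2 + 2 + ρ) →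
  ∃ C : ℝ, ∀ F : Site d → ℝ, LS24Assumption d K₁ K₂ ρ F →
    ∀ α : List (Fin d), α.length ≤ lsND d ρ →
      ∀ v : UnitAddTorus (Fin d) → ℂ, HasTorusWeakDeriv (ls24fHat F) α v →
        ∀ j : Fin d, ∀ u : ℝ, 0 ≤ u → u ≤ 1 →
          (∫ t, ‖torusDiff j u v t‖) ≤ C * u ^ η
```
[cite: LiuSlade2024, Proposition 2.11 (§2.3.2), Lemmas 2.10 and 2.12–2.14, and Theorem 1.2 (uniformity clause)]
It is exactly the `U_u`-hypothesis of `LiuSlade2024_lem29` for `hh = ls24fHat F`, `a = n_d + δ`,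
and it is the hypothesis `h211` of the sibling's `LiuSlade2024_thm12_critical_of_prop24`.

## In the sibling `LaceExpansionGaussianDeconvolutionProofs.lean` (proved there)

* `F̂ ∘ σ* = F̂` and `f̂ ∘ σ* = f̂` for symmetric `F` (`latticeFourier_torusSignedPerm`,
  `ls24fHat_torusSignedPerm`; the symmetry hypothesis of Lemma 2.9 for `h = f`);
* the absolute convergence of the Fourier integrals (1.5), (1.8) for `d > 2` from the infrared
  bounds (`integrable_inv_latticeFourier_of_infrared`, `integrable_inv_latticeFourier_lsA_one`,
  with (1.11) for `A_1` on the torus, `re_latticeFourier_lsA_one_ge`);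
* (1.10) in the critical case: the infrared bound forces `F'' ≥ dK₂/(2π²)` in the coordinate
  `k = 2πt` (`ls24Fpp_ge`, through the second-order expansion of `1 - Re Ĵ`, `J = δ - F`, along
  an axis);
* `f = G - λC_1` in the critical case (`fourierInverseG_sub_lambda_mul_srwGreen`);
* the exponent bookkeeping of the proof of Theorem 1.2 (`ls24_exists_exponents`:
  `a = n_d + δ ≥ d - 2 + s`, `η ∈ (δ, 1)`, `n_d + η < (d-2+ρ∧2) ∧ (d/2+2+ρ)`);
* the assembly `LiuSlade2024_thm12_critical_of_prop24 (h24 : LiuSlade2024_prop24)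
  (h211 : ⟨Proposition 2.11, the reading above⟩) : LiuSlade2024_thm12_critical` from Lemma 2.9
  (`LiuSlade2024_lem29_holds`), `srwGreen_eq_fourierInverseG_holds` and the Parts file's
  `srwGreen_asymp` ((1.6), `srwGreen_asymp_holds`).

So the open obligation `LiuSlade2024_thm12_critical` stands reduced, in Lean, to Proposition 2.4
(`LiuSlade2024_prop24`) and Proposition 2.11 (the hypothesis `h211`).

## Design notes

* Torus side throughout: translations `U_u`, Haar measure and Plancherel (`mFourierBasis`) live
  on `UnitAddTorus`; the cube-side objects of `LaceExpansionXSpaceAsymptotics.lean` are reached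
  through the bridges of the Parts file (`latticeFourier_coe_eq_latticeFT`).
* The coordinate `k = 2πt` rescales derivatives by `2π` per order and `U_u` by `2π` in `u`; the
  named facts absorb these factors in their constants (each docstring says how its reading is
  implied by the printed statement). Uniformity of constants in `F` (given `d, K₁, K₂, ρ, …`) is
  the uniformity clause of Theorem 1.2 ("The error estimate depends only on `d, K₁, K₂, ρ, s`").
* Equation numbers (1.1)–(1.13) are those of the arXiv version held in the literature store;
  results of §2 and Appendix A are cited by their theorem numbers and section.

What is deliberately NOT here: Lemmas 2.2, 2.5, 2.6, 2.10, 2.12–2.14 and Appendix A,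
Lemmas A.2–A.4 as separate facts (they sit behind Propositions 2.4 and 2.11 and are to be proved
with them; D-0026: no further named facts), Lemma 2.8 (behind Lemma 2.9), Lemma 2.3 (proved in
the Lem29 file), the non-critical case `F̂(0) > 0` of Theorem 1.2 (not used by the Parts file),
Corollary 1.3, Theorem 2.1.

## References

* Y. Liu, G. Slade, *Gaussian deconvolution and the lace expansion*, Probab. Theory Related
  Fields 195 (2024) 3–29, arXiv:2310.07635: §1.2 ((1.3)–(1.13), Assumption 1.1, Theorem 1.2),
  §2.1 (`A_μ`, `E_{λ,μ}`, `G = λC_μ + f`), §2.2 (`n_d`, Theorem 2.1, Lemmas 2.2–2.3, Prop. 2.4,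
  Lemmas 2.5–2.6, Remark 2.7), §2.3 (`U_u`, Lemmas 2.8–2.10, Prop. 2.11, proof of Thm. 1.2,
  Lemmas 2.12–2.14), Appendix A (Definition A.1, Lemmas A.2–A.4) [LiuSlade2024].
* Y. Liu, G. Slade, *Gaussian deconvolution and the lace expansion for spread-out models*,
  Ann. Inst. H. Poincaré Probab. Statist. 62 (2026), arXiv:2310.07640: (2.1), (2.7)
  (the objects of the Parts file) [LiuSlade2026].
* The external inputs of §2.3 named above are the source's references BO13 (Á. Bényi, T. Oh,
  *The Sobolev inequality on the torus revisited*, Publ. Math. Debrecen 83 (2013) 359–374; used in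
  Lemma 2.10) and Foll15 (G. B. Folland, *A Course in Abstract Harmonic Analysis*, 2nd ed., CRC
  Press, 2015; the Hausdorff–Young inequality used in Lemmas 2.6 and 2.14), quoted from the
  source's §2.3 and list of references.
-/

noncomputable section

namespace Literature.Barriers.CriticalPhenomena.SpreadOutIsing

open Filter UnitAddTorus Literature.Probability.LatticeModels
open Literature.Analysis.FunctionSpaces
open _root_.MeasureTheory _root_.Topology
open scoped Pointwise

variable {d : ℕ}

/-! ## Part A. Objects of Liu–Slade 2024, §1.2, §2 and Appendix A -/

/-- Iterated partial derivatives `∇^α φ = ∂_{l₁} ∂_{l₂} ⋯ ∂_{l_m} φ` of a test function on the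
torus, the multi-index `α` being recorded as the word `l = [l₁, …, l_m]` of coordinate directions
in which one differentiates (`|α| = m = l.length`; for smooth `φ` the order is immaterial, so every
word with `αᵢ` occurrences of the letter `i` gives the source's `∇^α = ∂^{|α|}/∂k₁^{α₁}⋯∂k_d^{α_d}`).
The partial derivatives are the tree's `Torus.partialDeriv` (directional derivatives of the lift to
`ℝ^d`, `Literature/Analysis/FunctionSpaces/TorusCalculus.lean`), in the coordinate `t` of
`UnitAddTorus (Fin d) = (ℝ/ℤ)^d`, i.e. `∇_t = 2π∇_k` for `k = 2πt`.
[cite: LiuSlade2024, §2.1 ("we write |α| = Σᵢ αᵢ and define the differential operator ∇^α")] -/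
def iterPartialDeriv (l : List (Fin d)) (φ : UnitAddTorus (Fin d) → ℝ) : UnitAddTorus (Fin d) → ℝ :=
  l.foldr (fun i ψ => Torus.partialDeriv i ψ) φ

/-- **Weak derivatives on the torus (Liu–Slade 2024, Definition A.1).** "Let `u ∈ L¹(𝕋^d)`. We say
that `u` is `n` times weakly differentiable if for each multi-index `α` with `|α| ≤ n` there is a
function `v_α ∈ L¹(𝕋^d)` such that for all test functions `φ ∈ C^∞(𝕋^d)`,
`∫ u ∇^α φ = (-1)^{|α|} ∫ v_α φ`. In this case, we call `v_α` the `α`-th weak derivative of `u`."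
`HasTorusWeakDeriv u l v` is the clause for one multi-index: `u, v ∈ L¹(𝕋^d)` (global `volume`,
the normalised Lebesgue measure `dk/(2π)^d` of the source) and `∫ (∇^l φ) u = (-1)^{|l|} ∫ φ v` for
every smooth real test function `φ` (`Torus.IsSmooth`, the test functions of the tree's
`Torus.HasWeakPartialDeriv`, of which this is the higher-order version: for `l = [j]` it is that
predicate, `HasTorusWeakDeriv.hasWeakPartialDeriv`); real test functions suffice (both sides are
`ℂ`-linear in `φ`). [cite: LiuSlade2024, Appendix A, Definition A.1 (weak derivatives)] -/
def HasTorusWeakDeriv (u : UnitAddTorus (Fin d) → ℂ) (l : List (Fin d))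
    (v : UnitAddTorus (Fin d) → ℂ) : Prop :=
  Integrable u ∧ Integrable v ∧
    ∀ φ : UnitAddTorus (Fin d) → ℝ, Torus.IsSmooth φ →
      ∫ t, iterPartialDeriv l φ t • u t = (-1 : ℂ) ^ l.length * ∫ t, φ t • v t

/-- **The difference operator `U_u` of Liu–Slade 2024, §2.3.1**, in the coordinate direction `j`:
`(U_u g)(t) = g(t + u e_j) - g(t - u e_j)` for a function `g` on the torus (the source takes
`j = 1`, `ũ = (u, 0, …, 0)`, and regards `g` as a periodic function on `ℝ^d`; on
`UnitAddTorus (Fin d)` the shift is the group translation by `u e_j`, `u ∈ ℝ` read modulo `1`, i.e.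
the source's `U_{2πu}` in the coordinate `k = 2πt`). [cite: LiuSlade2024, §2.3.1 (definition of U_u, the display preceding Lemma 2.8)] -/
def torusDiff (j : Fin d) (u : ℝ) (g : UnitAddTorus (Fin d) → ℂ) (t : UnitAddTorus (Fin d)) : ℂ :=
  g (t + Pi.single j ((u : ℝ) : UnitAddCircle)) - g (t - Pi.single j ((u : ℝ) : UnitAddCircle))

/-- The dual action `t ↦ (εᵢ t_{π⁻¹ i})ᵢ` of a signed coordinate permutation (`Site.signedPerm π ε`,
the "`ℤ^d`-symmetries of reflection in coordinate hyperplanes and rotation by `π/2`") on the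
torus, under which the characters transform by `e_x(σ* t) = e_{σ⁻¹x}(t)`
(`mFourier_torusSignedPerm`), so that `F̂ ∘ σ* = F̂` for `ℤ^d`-symmetric `F`.
[cite: LiuSlade2024, Assumption 1.1 (ℤ^d-symmetry)] -/
def torusSignedPerm (π : Equiv.Perm (Fin d)) (ε : Fin d → ℤˣ) (t : UnitAddTorus (Fin d)) :
    UnitAddTorus (Fin d) :=
  fun i => (ε i : ℤ) • t (π.symm i)

/-- **Liu–Slade 2024, Assumption 1.1** on `F : ℤ^d → ℝ` with constants `K₁, K₂, ρ`: "`F` is a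
`ℤ^d`-symmetric function (invariant under reflection in coordinate hyperplanes and rotation by
`π/2`) for which there are `K₁, K₂ > 0` and `ρ > (d-8)/2 ∨ 0` such that, for all `x ∈ ℤ^d` and
`k ∈ 𝕋^d`, `|F(x)| ≤ K₁/⟦x⟧^{d+2+ρ}`, `F̂(0) ≥ 0`, `F̂(k) - F̂(0) ≥ K₂|k|²`." Here `⟦x⟧ = |x| ∨ 1`
(`jnorm`), `F̂ = latticeFourier F` on the unit torus (coordinate `k = 2πt`, under which
`|k|² = 4π² Σᵢ ‖tᵢ‖²` with `‖·‖` the quotient norm of `ℝ/ℤ`; the factor `4π²` is absorbed in `K₂`),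
and `F̂` is real for symmetric `F`, so the two inequalities on `F̂` are written on real parts. The
side conditions `K₁, K₂ > 0`, `ρ > (d-8)/2 ∨ 0` are carried by the theorems.
[cite: LiuSlade2024, Assumption 1.1 with (1.9)] -/
def LS24Assumption (d : ℕ) (K₁ K₂ ρ : ℝ) (F : Site d → ℝ) : Prop :=
  IsZdSymmetric F ∧ (∀ x : Site d, |F x| ≤ K₁ / jnorm x ^ ((d : ℝ) + 2 + ρ)) ∧
    0 ≤ (latticeFourier F 0).re ∧
    ∀ t : UnitAddTorus (Fin d),
      K₂ * ∑ i, ‖t i‖ ^ 2 ≤ (latticeFourier F t).re - (latticeFourier F 0).re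

/-- `A_μ = δ - μ D_nn` (`D_nn(x) = 1{|x|=1}/(2d)` the nearest-neighbour step distribution, the
tree's `srwStep d`), so that `A_μ * C_μ = δ` for the lattice Green function `C_μ` of (1.3).
[cite: LiuSlade2024, §2.1 ("let A_μ = δ - μD")] -/
def lsA (d : ℕ) (μ : ℝ) (x : Site d) : ℝ := delta0 x - μ * srwStep d x

/-- The constant `F'' = -Σ_{x ∈ ℤ^d} |x|² F(x)` of (1.10). [cite: LiuSlade2024, (1.10)] -/
def ls24Fpp (F : Site d → ℝ) : ℝ := -∑' x, euclidNorm x ^ 2 * F x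

/-- The constant `λ = 1/(F̂(0) - Σ_x |x|²F(x)) = 1/(F̂(0) + F'')` of (1.12) (`F̂(0) = Σ_x F(x)`).
[cite: LiuSlade2024, (1.12)] -/
def ls24Lambda (F : Site d → ℝ) : ℝ := ((∑' x, F x) + ls24Fpp F)⁻¹

/-- The constant `μ = 1 - λ F̂(0)` of (1.12). [cite: LiuSlade2024, (1.12)] -/
def ls24Mu (F : Site d → ℝ) : ℝ := 1 - ls24Lambda F * ∑' x, F x

/-- The Fourier transform `f̂ = Ĉ Ê Ĝ = Ê/(Â F̂) = 1/F̂ - λ/Â_μ` of the error term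
`f = G - λC_μ = C_μ * E_{λ,μ} * G` of §2.1 (the last identity because `E_{λ,μ} = A_μ - λF`), as a
function on the unit torus. [cite: LiuSlade2024, §2.1 (displays "G = λC_μ + f, f = C_μ * E_{λ,μ} * G") and Proposition 2.4 ("f̂ = ĈÊĜ")] -/
def ls24fHat (F : Site d → ℝ) (t : UnitAddTorus (Fin d)) : ℂ :=
  (latticeFourier F t)⁻¹ - (ls24Lambda F : ℂ) * (latticeFourier (lsA d (ls24Mu F)) t)⁻¹

/-! ### Elementary API -/

/-- `∇^{[]} φ = φ`. [folklore] -/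
@[simp] theorem iterPartialDeriv_nil (φ : UnitAddTorus (Fin d) → ℝ) : iterPartialDeriv [] φ = φ := rfl

/-- `∇^{i :: l} φ = ∂ᵢ ∇^l φ`. [folklore] -/
@[simp] theorem iterPartialDeriv_cons (i : Fin d) (l : List (Fin d)) (φ : UnitAddTorus (Fin d) → ℝ) :
    iterPartialDeriv (i :: l) φ = Torus.partialDeriv i (iterPartialDeriv l φ) := rfl

/-- An integrable function is its own weak derivative of order zero. [cite: LiuSlade2024, Appendix A, Definition A.1 (weak derivatives)] -/
theorem hasTorusWeakDeriv_nil {u : UnitAddTorus (Fin d) → ℂ} (hu : Integrable u) :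
    HasTorusWeakDeriv u [] u :=
  ⟨hu, hu, fun φ _ => by simp⟩

/-- For a single direction `l = [j]`, Definition A.1 is the tree's first-order predicate
`Torus.HasWeakPartialDeriv j u v` (`∫ ∂ⱼφ • u = -∫ φ • v`). [cite: LiuSlade2024, Appendix A, Definition A.1 (weak derivatives)] -/
theorem HasTorusWeakDeriv.hasWeakPartialDeriv {u v : UnitAddTorus (Fin d) → ℂ} {j : Fin d}
    (h : HasTorusWeakDeriv u [j] v) : Torus.HasWeakPartialDeriv j u v := by
  intro φ hφ
  have := h.2.2 φ hφ
  simpa using this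

/-- `U_0 = 0`. [cite: LiuSlade2024, §2.3.1 (definition of U_u, the display preceding Lemma 2.8)] -/
@[simp] theorem torusDiff_zero_left (j : Fin d) (g : UnitAddTorus (Fin d) → ℂ)
    (t : UnitAddTorus (Fin d)) : torusDiff j 0 g t = 0 := by
  simp [torusDiff]

/-- The hypotheses of Assumption 1.1 unfolded. [cite: LiuSlade2024, Assumption 1.1] -/
theorem ls24Assumption_iff (K₁ K₂ ρ : ℝ) (F : Site d → ℝ) :
    LS24Assumption d K₁ K₂ ρ F ↔
      IsZdSymmetric F ∧ (∀ x : Site d, |F x| ≤ K₁ / jnorm x ^ ((d : ℝ) + 2 + ρ)) ∧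
        0 ≤ (latticeFourier F 0).re ∧
        ∀ t : UnitAddTorus (Fin d),
          K₂ * ∑ i, ‖t i‖ ^ 2 ≤ (latticeFourier F t).re - (latticeFourier F 0).re := Iff.rfl

/-- In the critical case `F̂(0) = Σ_x F(x) = 0`: `μ = 1`. [cite: LiuSlade2024, (1.12) ("For the critical case of F̂(0) = 0, we have μ = 1 and λ = F''⁻¹")] -/
theorem ls24Mu_of_tsum_eq_zero {F : Site d → ℝ} (h : ∑' x, F x = 0) : ls24Mu F = 1 := by
  simp [ls24Mu, h]

/-- In the critical case `F̂(0) = Σ_x F(x) = 0`: `λ = 1/F''`. [cite: LiuSlade2024, (1.12)] -/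
theorem ls24Lambda_of_tsum_eq_zero {F : Site d → ℝ} (h : ∑' x, F x = 0) :
    ls24Lambda F = (ls24Fpp F)⁻¹ := by
  simp [ls24Lambda, h]

/-- `A_1 = δ - D_nn` unfolded. [cite: LiuSlade2024, §2.1] -/
theorem lsA_one (x : Site d) : lsA d 1 x = delta0 x - srwStep d x := by simp [lsA]

/-! ## Part B. The deep inputs of the proof of Theorem 1.2, as named facts -/

/-- NAMED FACT — **Liu–Slade 2024, Lemma 2.9** (decay of Fourier coefficients from a fractional
smoothness estimate on the top-order weak derivatives): "Let `d > 0` and let `h : ℤ^d → ℂ` be the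
inverse Fourier transform of `ĥ`. Suppose that `h` is `ℤ^d`-symmetric, that `a > 0` is not an
integer, and that `ĥ` is `⌊a⌋` times weakly differentiable. Suppose also that, for some
`η ∈ (a - ⌊a⌋, 1)` and for all `|α| = ⌊a⌋`, there is a `K_α > 0` such that
`‖U_u ĥ_α‖₁ ≤ u^η K_α` (`0 ≤ u ≤ 1`). Then there is a constant `c_{d,a,η}` depending only on
`d, a, η` such that `|h(x)| ≤ c_{d,a,η} ⟦x⟧^{-a} (‖ĥ‖₁ + max_{|α|=⌊a⌋}(K_α + ‖ĥ_α‖₁))`."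
Transcription: `h(x) = ∫ ĥ e^{-ik·x} dk/(2π)^d` is `mFourierCoeff ĥ x`; the `ℤ^d`-symmetry of
`h` is required in the (stronger) form of the invariance of `ĥ` under the dual action
`torusSignedPerm` of the signed coordinate permutations (which is how it arises, `ĥ` being built
from transforms of symmetric functions); "`⌊a⌋` times weakly differentiable" is a family `v β` of
weak derivatives for `|β| ≤ ⌊a⌋` (`HasTorusWeakDeriv`, Appendix A, Definition A.1, multi-indices
as words of directions); the `L¹` norms are
`∫ ‖·‖` for the Haar probability measure (`dk/(2π)^d`); the maxima over `|α| = ⌊a⌋` are replaced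
by common upper bounds `K`, `M` (equivalent); the `U_u`-hypothesis is required for `0 ≤ u ≤ 1`
in the coordinate `t = k/2π` (shifts up to `2π` in `k`, a stronger hypothesis) and in EVERY
coordinate direction `j` (`torusDiff j`; the printed proof uses direction `1` and then "By
symmetry, the above also holds with `x₁` replaced by `x_j`"). With these readings the statement
is implied by the printed one. Proof: Lemma 2.8 (the integral representation of the
Fourier transform of `sgn(x₁)|x₁|^δ g(x)`) and Fubini; not proved here.
[cite: LiuSlade2024, Lemma 2.9 (§2.3.1) and Lemma 2.8] -/
def LiuSlade2024_lem29 : Prop :=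
  ∀ d : ℕ, 0 < d → ∀ a η : ℝ, 0 < a → Int.fract a ≠ 0 → Int.fract a < η → η < 1 →
    ∃ c : ℝ, 0 < c ∧
      ∀ (hh : UnitAddTorus (Fin d) → ℂ) (v : List (Fin d) → UnitAddTorus (Fin d) → ℂ) (K M : ℝ),
        Integrable hh →
        (∀ (π : Equiv.Perm (Fin d)) (ε : Fin d → ℤˣ) (t : UnitAddTorus (Fin d)),
          hh (torusSignedPerm π ε t) = hh t) →
        (∀ β : List (Fin d), β.length ≤ ⌊a⌋₊ → HasTorusWeakDeriv hh β (v β)) →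
        (∀ α : List (Fin d), α.length = ⌊a⌋₊ → (∫ t, ‖v α t‖) ≤ M) →
        (∀ α : List (Fin d), α.length = ⌊a⌋₊ → ∀ j : Fin d, ∀ u : ℝ, 0 ≤ u → u ≤ 1 →
          (∫ t, ‖torusDiff j u (v α) t‖) ≤ K * u ^ η) →
        ∀ x : Site d, ‖mFourierCoeff hh x‖ ≤ c / jnorm x ^ a * ((∫ t, ‖hh t‖) + K + M)

/-- NAMED FACT — **Liu–Slade 2024, Proposition 2.4** (with the `L^r`-integrability from its proof
and the uniformity of constants asserted in Theorem 1.2): "Let `F` obey Assumption 1.1. Then the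
function `f̂ = Ĉ Ê Ĝ` is `n_d` times weakly differentiable" — and, from the proof, `f̂_α ∈ L^r(𝕋^d)`
for `r⁻¹ > (|α| + 2 - ρ ∧ 2)/d` (last display of its proof), in particular `f̂, f̂_α ∈ L¹` with norms bounded in terms
of `d, K₁, K₂, ρ` only (every estimate entering the proof — Lemma 2.2 (`|Ê_α| ≤ cK|k|^{2+σ-|α|}`),
Lemma 2.5, Lemma 2.6 (`‖ĥ‖_q ≤ c_{d,b,q}K`), the infrared bounds for `Â_μ` and `F̂` — is of the form
constant `× K` with `K ∈ {K₁, K₂⁻¹, K_E}`; this is the uniformity "The error estimate in (1.13)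
depends only on `d, K₁, K₂, ρ, s`" of Theorem 1.2). Here `d > 2`, `n_d = d - 2 + s₀` is the first
display of §2.2 (`lsND d ρ`, the same display as Liu–Slade 2026 (2.7)), `f̂ = ls24fHat F`
(`= 1/F̂ - λ/Â_μ`), and weak derivatives are `HasTorusWeakDeriv` (Appendix A, Definition A.1;
multi-indices as words of directions). Proof: Lemmas 2.2, 2.5, 2.6 (Hausdorff–Young) and the
product and quotient rules for weak derivatives (Appendix A, Lemmas A.2–A.4); not proved here.
[cite: LiuSlade2024, Proposition 2.4 with its proof (§2.2.1: f̂_α ∈ L^r for r⁻¹ > (|α| + 2 - ρ∧2)/d), Lemma 2.5, and Theorem 1.2 (uniformity clause)] -/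
def LiuSlade2024_prop24 : Prop :=
  ∀ d : ℕ, 2 < d → ∀ K₁ K₂ ρ : ℝ, 0 < K₁ → 0 < K₂ → max (((d : ℝ) - 8) / 2) 0 < ρ →
    ∃ C : ℝ, ∀ F : Site d → ℝ, LS24Assumption d K₁ K₂ ρ F →
      Integrable (ls24fHat F) ∧ (∫ t, ‖ls24fHat F t‖) ≤ C ∧
        ∀ α : List (Fin d), α.length ≤ lsND d ρ →
          ∃ v : UnitAddTorus (Fin d) → ℂ, HasTorusWeakDeriv (ls24fHat F) α v ∧ (∫ t, ‖v t‖) ≤ C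

/-- NAMED FACT — **the lattice Green function is the Fourier integral (1.5)**: "`C_1(x)` is the
expected number of visits to `x` by a simple random walk started from the origin. The solution to
(1.3) can be obtained using the (inverse) Fourier transform … in dimensions `d > 2`, `C_μ` is given
by the absolutely convergent integral `C_μ(x) = ∫_{𝕋^d} e^{-ik·x}/(1 - μD̂(k)) dk/(2π)^d` …
Although `C_1` is not summable, it is nevertheless a standard fact that (1.5) does give a solution
to (1.3) when `μ = 1`." Vendored as the identity, for `d > 2`, between the expected number of
visits `Σ_{n ≥ 0} D_nn^{*n}(x)` (`srwGreen d x`, the tree's random-walk Green function of the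
Parts file) and the Fourier integral (1.5) at `μ = 1` (`fourierInverseG (lsA d 1) x`, the integral
(1.8) = Liu–Slade 2026 (2.1) for `F = A_1 = δ - D_nn`, whose transform is `1 - D̂_nn`). Classical
(geometric series for `μ < 1`, then monotone and dominated convergence as `μ ↑ 1`, using the
integrability of `1/(1 - D̂_nn)` for `d > 2`); not proved here.
[cite: LiuSlade2024, §1.2, (1.3)–(1.5) and the sentence following (1.6)] -/
def srwGreen_eq_fourierInverseG : Prop :=
  ∀ d : ℕ, 2 < d → ∀ x : Site d, srwGreen d x = fourierInverseG (lsA d 1) x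

end Literature.Barriers.CriticalPhenomena.SpreadOutIsing

end
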